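import Literature.NumberTheory.LFunctions.RiemannHypothesisUpToRSCertificateExplicit
import Literature.NumberTheory.LFunctions.RiemannHypothesisUpTo100000Chunk02
import HarnessLib

/-!
# `RiemannHypothesisUpTo 100000` unconditionally — chunk 2 of 12 re-certified with the PROVED remainder

Topic `Literature/NumberTheory/LFunctions`. ONE compiled evaluation (`native_decide`) of the checker
`Literature.NumberTheory.LFunctions.RSCert.checkChunkX` (`RiemannHypothesisUpToRSCertificateExplicit.lean`),
whose Riemann–Siegel signs rest on the tree's PROVED remainder bound
`Literature.NumberTheory.LFunctions.Gabcke.abs_R0_le_explicit_of_ge` instead of the named fact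
`Gabcke.satz322b_R0`, on the certificate data of `RiemannHypothesisUpTo100000Chunk02.lean`
(`Literature.NumberTheory.LFunctions.RHT100000.low02`: 11600 gaps, unit `2^{-10}`, from
`11501000/2^10 ≈ 11231.445` with sign `false` to `21044283/2^10 ≈ 20551.058` with sign `false`).
Assembled in `RiemannHypothesisUpTo100000X.lean`. The only non-standard axiom is the `native_decide`
auxiliary of `chunk02X` (proposal flag `computational`); NO named fact.

## References

* R. P. Brent, Math. Comp. 33 (1979) 1361–1372, §3–§4. [Brent1979]
* W. Gabcke, Dissertation Göttingen 1979, Satz 3.2.2. [Gabcke1979]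
* H. M. Edwards, *Riemann's Zeta Function* (1974), §8.2. [EdwardsZeta1974]
-/

namespace Literature.NumberTheory.LFunctions.RHT100000

open RSCert

/-- Chunk 2 re-certified with the proved remainder: 11600 certified sign changes of `Z` from
`≈ 11231.445` to `≈ 20551.058` (compiled evaluation; no named fact). [cite: Brent1979, §3] -/
theorem chunk02X :
    checkChunkX 128 128 12 10 11501000 false low02 = some (21044283, false) := by
  native_decide

end Literature.NumberTheory.LFunctions.RHT100000
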